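import Summits.HodgeConjecture.HodgeConjecture.Theorems.P2H413OfSockets
import Summits.HodgeConjecture.HodgeConjecture.Theorems.P2StubU2OfLettersCD
import HarnessLib

/-!
# Crux `H413` — the crux BY NAME from the P2 sockets {(C), (D), U4} and the floor rows `hJ3a`, `hocc`: the (C′)-FREE head at Theorems level

Cell hodgecm-mathlib (D-0151), FLOOR 0, crux item H413 = stmt-HodgeConjecture-24833; programme P2.  Author F0P2-p01 (g2).  THEOREMS ONLY;
`--supports stmt-HodgeConjecture-24833 --as helper`.  HC_CM is proved only modulo the 7 printed citations until rung 0 closes; this file proves nothing about them.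

The parent line of record `Lines/P2ThetaDictionaryExists.lean` v4c has sockets {(C) `Rogawski1990.cohFinComponent_isTheta`, (D)
`CotangentForms.holCotFormSpectralProjection`, U4 `StubU4SignRule`} after F0P2-p02 (g0)'s ★ p796532 `P2StubU2OfLettersCD.stub_U2_cohFormsSpectrumIsThetaAt_of_C_D`
removed (C′) (via the ★ P4 master) and ★ p794879 removed (D̄).  The Theorems-level heads ★ `P2H413OfSockets.H413_of_sockets(')` (p795208) still thread (C′); this file records
the (C′)-free composition (ref1 N28-1).  Its instance with (D) := the (D)-desk assembly ★ `F0P2dSocketDOfStubs.holCotFormSpectralProjection_of_KSR` (p797808) lives in the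
successor `Theorems/F0P2dSocketD.lean` (which discharges (K), (S), (R) by name as they land).

* `hdictE_of_sockets_CD (hC) (hD) (hU4) : HdictEType` — ★ `oscillatorTriple_dictionaryExistence_holds_of` at U1′ := ★ `TowerRealisation.stubU1RealisationAt_holds`,
  U2′ := ★ `stub_U2_cohFormsSpectrumIsThetaAt_of_C_D hC hD`;
* `H413_of_sockets_CD (hC) (hD) (hU4) (hJ3a) (hocc)` — ★ `Hyp413Closing.H413_of_three_facts_flat`.

## References
* [Liu2021] Prop. 4.13 and proof l. 2121–2146, Rem. 4.14.  [GelbartRogawski1991] Introduction p. 448; Thm 5.1.1.  [Rogawski1990] Thm. 13.3.1.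
* [BorelJacquet1979] §4.6.  [Borel1997] Thm. 2.13.
-/

set_option autoImplicit false

-- the mandated namespace has the single-problem summit's repeated segment (`HodgeConjecture.HodgeConjecture`)
set_option linter.dupNamespace false

noncomputable section

namespace Summit.HodgeConjecture.HodgeConjecture.Cruxes.H413.P2H413OfSocketsCD

open Literature.NumberTheory.Automorphic.UnitaryGroup.CotangentForms (holCotFormSpectralProjection)
open Summit.HodgeConjecture.HodgeConjecture.Cruxes.H413.SpectrumInterfaces (StubU4SignRule HJ3aType HoccType HdictEType
  oscillatorTriple_dictionaryExistence_holds_of)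

set_option synthInstance.maxHeartbeats 400000 in
set_option maxHeartbeats 8000000 in
/-- **The floor row `hdictE` from the P2 sockets {C, D, U4}** (U1′ ★ inside; U2′ := ★ `stub_U2_cohFormsSpectrumIsThetaAt_of_C_D hC hD`).
[cite: Liu2021, proof of Prop. 4.13, l. 2145; Rem. 4.14] [cite: GelbartRogawski1991, Introduction p. 448 L30–33; Thm 5.1.1 p. 465] -/
theorem hdictE_of_sockets_CD (hC : Literature.NumberTheory.Rogawski1990.cohFinComponent_isTheta)
    (hD : holCotFormSpectralProjection) (hU4 : StubU4SignRule) : HdictEType :=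
  oscillatorTriple_dictionaryExistence_holds_of TowerRealisation.stubU1RealisationAt_holds
    (P2StubU2OfLettersCD.stub_U2_cohFormsSpectrumIsThetaAt_of_C_D hC hD) hU4

set_option synthInstance.maxHeartbeats 400000 in
set_option maxHeartbeats 8000000 in
/-- **THE CRUX `HCCMUnconditional.H413` BY NAME FROM THE P2 SOCKETS {C, D, U4} AND THE ROWS `hJ3a` (P3), `hocc` (P4)** — no (C′), no (D̄).
[cite: Liu2021, Prop. 4.13 and proof l. 2121–2146; Rem. 4.14] [cite: GelbartRogawski1991, Introduction p. 448; Thm 5.1.1] [cite: Rogawski1990, Thm. 13.3.1] -/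
theorem H413_of_sockets_CD (hC : Literature.NumberTheory.Rogawski1990.cohFinComponent_isTheta)
    (hD : holCotFormSpectralProjection) (hU4 : StubU4SignRule) (hJ3a : HJ3aType) (hocc : HoccType) :
    Summit.HodgeConjecture.HodgeConjecture.Theses.HCCMUnconditional.H413 :=
  Summit.HodgeConjecture.CorCM.Hyp413Closing.H413_of_three_facts_flat (hdictE_of_sockets_CD hC hD hU4) hJ3a hocc

end Summit.HodgeConjecture.HodgeConjecture.Cruxes.H413.P2H413OfSocketsCD

end
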